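import Summits.Parity.BatemanHorn.Theorems.SoloInformedWindowRootFourierLocated
import Literature.NumberTheory.LFunctions.PlateauMollifier

/-!
# The smooth hyperbola split of `∑ τ(|g(n)|)` — exact, with no transition error

Informed soloist `solo-Parity-informed` (session 142), conjunct `BatemanHorn`, the `d ≥ 3` rung BELOW the parity
wall (Erdős 1952, `S_g(x) = ∑_{n ≤ x} τ(|g(n)|)`; SHARPEST-STATEMENT annex §4.A, paper Remark 20.29).  Sequel to
`SoloInformedWindowRootFourier{,Located}`: there the located root count `Mid_g(x)` (divisors `e` of `g(n)` with
`x < e < √|g(n)|`) was written EXACTLY as a bilinear form `∑_e (1/e) ∑_{0<h<e} F_{B_g(x;e)}(h; e)·S_g(h; e)` in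
Hooley's sums `S_g(h; e) = ∑_{ν root mod e} e(hν/e)`, with the Fourier coefficients of the SHARP sets
`B_g(x; e) = {n ≤ x : e² < |g(n)|}` as weights.  The sharp cut-off at `√|g(n)|` is what makes those weights rough in
`e` (a staircase phase `e(−h·n_e/e)`), and smoothing it by brute force would cost a divisor-near-the-square-root
estimate that is not available.  This file removes the problem at no cost, by the involution `d ↦ |g(n)|/d`:

* `card_divisors_eq_two_mul_sum_weight`: for EVERY weight `w` with `w(t) + w(1/t) = 1` (`t > 0`) and every
  `N ≠ 0`, `τ(N) = 2·∑_{d ∣ N} w(d/√N)` — EXACT (the smooth hyperbola method; the square divisor, if any, is the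
  fixed point `w(1) = 1/2`).
* `hypWeight Δ t = max 0 (min 1 ((Δ − log t)/(2Δ)))`: the log-linear clamp, `= 1` for `t ≤ e^{−Δ}`, `= 0` for
  `t ≥ e^{Δ}`, antitone, `1/(2Δ)`-Lipschitz in `log t`, with `hypWeight Δ t + hypWeight Δ t⁻¹ = 1`
  (`hypWeight_add_inv`).  `Δ > 0` is a FIXED parameter — nothing below needs `Δ → 0`.
* `locWeight g Δ e n = hypWeight Δ (e/√|g(n)|)` and the smooth storeys
  `polySmoothSmall g Δ x = ∑_{n≤x} ∑_{e ∣ g(n), e ≤ x} locWeight`, `polySmoothMid g Δ x = ∑_{n≤x} ∑_{e ∣ g(n), e > x} locWeight`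
  with the EXACT split `S_g(x) = 2·polySmoothSmall + 2·polySmoothMid` (`polyDivisorSum_eq_two_mul_smooth`; `g ≠ 0`
  on `[1, x]`), `polySmoothSmall ≤ polySmallStorey` and
  `polySmallStorey − polySmoothSmall ≤ ∑_{n ≤ x, |g(n)| < e^{2Δ}x²} τ(|g(n)|)` (`polySmallStorey_sub_smooth_le`:
  only the `n ≪ x^{2/d}` with `|g(n)| < e^{2Δ}x²` see the weight at all below `x`).
* Fubini past `x`: `polySmoothMid g Δ x = ∑_{x<e≤E} ∑_{ν root of g mod e, 1 ≤ ν ≤ x} locWeight g Δ e ν`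
  (`polySmoothMid_eq_sum`), and the smooth CRT heuristic `polySmoothHeur g Δ x E = ∑_{x<e≤E} (ρ_g(e)/e)·∑_{n≤x} locWeight g Δ e n`.

The sequel `SoloInformedSmoothHyperbolaFourier` expands `polySmoothMid − polySmoothHeur` on `ℤ/e` and performs ONE
Abel summation in `n`, after which every weight is a boundary phase `e(−hb/e)` — i.e. a SHIFT `g(X) ↦ g(X + b)` of
the Hooley sum — and the open content of the rung is typed in Hooley's own currency (uniform power savings in
`∑_{E<e≤E'} S_{g(X+b)}(h; e)`); see that file's docstring for the target implication and its honest range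
(`d = 3` only).  Everything here is exact finite algebra; nothing moves a wall row; verdict NO PATH unchanged.
-/

namespace Summit.Parity.BatemanHorn.Theorems

open Finset Polynomial
open Literature.NumberTheory.Sieve (polyRootCountMod)

/-! ### The log-linear clamp (the `1`-Lipschitz property of the clamp is
`Literature.NumberTheory.LFunctions.PlateauMollifier.abs_clamp_sub_clamp_le`) -/

/-- The hyperbola weight `w_Δ(t) = max 0 (min 1 ((Δ − log t)/(2Δ)))`. [this work] -/
noncomputable def hypWeight (Δ t : ℝ) : ℝ :=
  max 0 (min 1 ((Δ - Real.log t) / (2 * Δ)))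

/-- `0 ≤ w_Δ(t)`. [folklore] -/
theorem hypWeight_nonneg (Δ t : ℝ) : 0 ≤ hypWeight Δ t :=
  le_max_left _ _

/-- `w_Δ(t) ≤ 1`. [folklore] -/
theorem hypWeight_le_one (Δ t : ℝ) : hypWeight Δ t ≤ 1 :=
  max_le zero_le_one (min_le_left _ _)

/-- The clamp identity `max 0 (min 1 u) + max 0 (min 1 (1 − u)) = 1`. [folklore] -/
theorem clamp_add_clamp_one_sub (u : ℝ) : max 0 (min 1 u) + max 0 (min 1 (1 - u)) = 1 := by
  simp only [max_def, min_def]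
  split_ifs <;> linarith

/-- **The involution property** `w_Δ(t) + w_Δ(1/t) = 1` (`Δ ≠ 0`; all real `t`, with Mathlib's `log`). [this work] -/
theorem hypWeight_add_inv {Δ : ℝ} (hΔ : Δ ≠ 0) (t : ℝ) :
    hypWeight Δ t + hypWeight Δ t⁻¹ = 1 := by
  unfold hypWeight
  have h : (Δ - Real.log t⁻¹) / (2 * Δ) = 1 - (Δ - Real.log t) / (2 * Δ) := by
    rw [Real.log_inv]
    field_simp
    ring
  rw [h]
  exact clamp_add_clamp_one_sub _

/-- `w_Δ(t) = 1` when `log t ≤ −Δ` (`Δ > 0`). [this work] -/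
theorem hypWeight_eq_one {Δ t : ℝ} (hΔ : 0 < Δ) (ht : Real.log t ≤ -Δ) : hypWeight Δ t = 1 := by
  unfold hypWeight
  have h1 : 1 ≤ (Δ - Real.log t) / (2 * Δ) := by
    rw [le_div_iff₀ (by positivity)]
    linarith
  rw [min_eq_left h1, max_eq_right zero_le_one]

/-- `w_Δ(t) = 0` when `Δ ≤ log t` (`Δ > 0`). [this work] -/
theorem hypWeight_eq_zero {Δ t : ℝ} (hΔ : 0 < Δ) (ht : Δ ≤ Real.log t) : hypWeight Δ t = 0 := by
  unfold hypWeight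
  have h1 : (Δ - Real.log t) / (2 * Δ) ≤ 0 :=
    div_nonpos_of_nonpos_of_nonneg (by linarith) (by positivity)
  rw [min_eq_right (h1.trans zero_le_one), max_eq_left h1]

/-- The clamp is monotone. [folklore] -/
theorem clamp_mono {u v : ℝ} (huv : u ≤ v) : max 0 (min 1 u) ≤ max 0 (min 1 v) :=
  max_le_max le_rfl (min_le_min le_rfl huv)

/-- `w_Δ` is antitone on `(0, ∞)` (`Δ > 0`). [this work] -/
theorem hypWeight_antitone {Δ : ℝ} (hΔ : 0 < Δ) {t₁ t₂ : ℝ} (ht₁ : 0 < t₁) (h : t₁ ≤ t₂) :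
    hypWeight Δ t₂ ≤ hypWeight Δ t₁ := by
  unfold hypWeight
  refine clamp_mono (div_le_div_of_nonneg_right ?_ (by positivity))
  linarith [Real.log_le_log ht₁ h]

/-- `w_Δ` is `1/(2Δ)`-Lipschitz in `log t`: `|w_Δ(t₁) − w_Δ(t₂)| ≤ |log t₁ − log t₂|/(2Δ)` (`Δ > 0`). [this work] -/
theorem abs_hypWeight_sub_le {Δ : ℝ} (hΔ : 0 < Δ) (t₁ t₂ : ℝ) :
    |hypWeight Δ t₁ - hypWeight Δ t₂| ≤ |Real.log t₁ - Real.log t₂| / (2 * Δ) := by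
  unfold hypWeight
  refine (Literature.NumberTheory.LFunctions.PlateauMollifier.abs_clamp_sub_clamp_le _ _).trans ?_
  rw [← sub_div, abs_div, abs_of_pos (by positivity : (0 : ℝ) < 2 * Δ)]
  refine div_le_div_of_nonneg_right (le_of_eq ?_) (by positivity)
  rw [show Δ - Real.log t₁ - (Δ - Real.log t₂) = -(Real.log t₁ - Real.log t₂) by ring, abs_neg]

/-! ### The smooth hyperbola identity -/

/-- **THE SMOOTH HYPERBOLA IDENTITY**: for every weight `w` with `w(t) + w(1/t) = 1` on `t > 0` and every `N ≠ 0`,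
`τ(N) = 2·∑_{d ∣ N} w(d/√N)`, EXACTLY (pair `d` with `N/d`: `(N/d)/√N = (d/√N)⁻¹`). [folklore] -/
theorem card_divisors_eq_two_mul_sum_weight (w : ℝ → ℝ) (hw : ∀ t : ℝ, 0 < t → w t + w t⁻¹ = 1) {N : ℕ}
    (hN : N ≠ 0) : (#N.divisors : ℝ) = 2 * ∑ d ∈ N.divisors, w (d / Real.sqrt N) := by
  set s : ℝ := Real.sqrt N with hs
  have hNpos : (0 : ℝ) < N := by exact_mod_cast Nat.pos_of_ne_zero hN
  have hspos : 0 < s := Real.sqrt_pos.mpr hNpos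
  have hss : s * s = N := Real.mul_self_sqrt hNpos.le
  have h1 : ∑ d ∈ N.divisors, w (d / s) = ∑ i ∈ N.divisorsAntidiagonal, w (i.1 / s) :=
    (Nat.sum_divisorsAntidiagonal fun a _ => w (a / s)).symm
  have h2 : ∑ d ∈ N.divisors, w (d / s) = ∑ i ∈ N.divisorsAntidiagonal, w (i.2 / s) :=
    (Nat.sum_divisorsAntidiagonal' fun _ b => w (b / s)).symm
  have hcard : (#N.divisors : ℝ) = ∑ _i ∈ N.divisorsAntidiagonal, (1 : ℝ) := by
    rw [sum_const, nsmul_eq_mul, mul_one, ← Nat.map_div_right_divisors, card_map]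
  have h12 : 2 * ∑ d ∈ N.divisors, w (d / s)
      = ∑ i ∈ N.divisorsAntidiagonal, w (i.2 / s) + ∑ i ∈ N.divisorsAntidiagonal, w (i.1 / s) := by
    rw [two_mul, ← h1, ← h2]
  rw [h12, hcard, ← sum_add_distrib]
  refine sum_congr rfl fun i hi => ?_
  obtain ⟨hprod, -⟩ := Nat.mem_divisorsAntidiagonal.mp hi
  have ha : (0 : ℝ) < i.1 := by
    exact_mod_cast Nat.pos_of_ne_zero (Nat.left_ne_zero_of_mem_divisorsAntidiagonal hi)
  have hb : (i.2 : ℝ) / s = ((i.1 : ℝ) / s)⁻¹ := by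
    have hab : (i.1 : ℝ) * i.2 = s * s := by rw [hss]; exact_mod_cast hprod
    rw [inv_div, div_eq_div_iff hspos.ne' ha.ne']
    linear_combination hab
  rw [hb, add_comm]
  exact (hw _ (div_pos ha hspos)).symm

/-! ### The smooth storeys -/

/-- `s_n = √|g(n)|`. [this work] -/
noncomputable def sqrtAbsEval (g : ℤ[X]) (n : ℕ) : ℝ :=
  Real.sqrt ((g.eval (n : ℤ)).natAbs : ℝ)

/-- `sqrtAbsEval` is positive when `g(n) ≠ 0`. [folklore] -/
theorem sqrtAbsEval_pos (g : ℤ[X]) {n : ℕ} (hn : g.eval (n : ℤ) ≠ 0) : 0 < sqrtAbsEval g n := by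
  unfold sqrtAbsEval
  exact Real.sqrt_pos.mpr (by exact_mod_cast Nat.pos_of_ne_zero (Int.natAbs_ne_zero.mpr hn))

/-- The located weight `a_e(n) = w_Δ(e/√|g(n)|)`. [this work] -/
noncomputable def locWeight (g : ℤ[X]) (Δ : ℝ) (e n : ℕ) : ℝ :=
  hypWeight Δ ((e : ℝ) / sqrtAbsEval g n)

/-- `0 ≤ a_e(n) ≤ 1`. [folklore] -/
theorem locWeight_nonneg (g : ℤ[X]) (Δ : ℝ) (e n : ℕ) : 0 ≤ locWeight g Δ e n :=
  hypWeight_nonneg _ _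

/-- `a_e(n) ≤ 1`. [folklore] -/
theorem locWeight_le_one (g : ℤ[X]) (Δ : ℝ) (e n : ℕ) : locWeight g Δ e n ≤ 1 :=
  hypWeight_le_one _ _

/-- `a_e(n) = 1` when `e²·e^{2Δ} ≤ |g(n)|` (`e ≥ 1`, `Δ > 0`). [this work] -/
theorem locWeight_eq_one (g : ℤ[X]) {Δ : ℝ} (hΔ : 0 < Δ) {e n : ℕ} (he : 1 ≤ e)
    (h : ((e : ℝ) * Real.exp Δ) ^ 2 ≤ ((g.eval (n : ℤ)).natAbs : ℝ)) : locWeight g Δ e n = 1 := by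
  unfold locWeight
  have hepos : (0 : ℝ) < e := by exact_mod_cast he
  have hprod : 0 < (e : ℝ) * Real.exp Δ := mul_pos hepos (Real.exp_pos Δ)
  have hs : (e : ℝ) * Real.exp Δ ≤ sqrtAbsEval g n := by
    unfold sqrtAbsEval
    rw [← Real.sqrt_sq hprod.le]
    exact Real.sqrt_le_sqrt h
  have hspos : 0 < sqrtAbsEval g n := hprod.trans_le hs
  refine hypWeight_eq_one hΔ ?_
  rw [Real.log_le_iff_le_exp (div_pos hepos hspos), div_le_iff₀ hspos]
  calc (e : ℝ) = (e : ℝ) * Real.exp Δ * Real.exp (-Δ) := by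
        rw [mul_assoc, ← Real.exp_add, add_neg_cancel, Real.exp_zero, mul_one]
    _ ≤ sqrtAbsEval g n * Real.exp (-Δ) := mul_le_mul_of_nonneg_right hs (Real.exp_pos _).le
    _ = Real.exp (-Δ) * sqrtAbsEval g n := mul_comm _ _

/-- `a_e(n) = 0` when `|g(n)|·e^{2Δ} ≤ e²` (`g(n) ≠ 0`, `Δ > 0`): the weight is LOCATED below `e^{Δ}√|g(n)|`. [this work] -/
theorem locWeight_eq_zero (g : ℤ[X]) {Δ : ℝ} (hΔ : 0 < Δ) {e n : ℕ} (hn : g.eval (n : ℤ) ≠ 0)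
    (h : ((g.eval (n : ℤ)).natAbs : ℝ) * (Real.exp Δ) ^ 2 ≤ (e : ℝ) ^ 2) : locWeight g Δ e n = 0 := by
  unfold locWeight
  have hspos : 0 < sqrtAbsEval g n := sqrtAbsEval_pos g hn
  have hprod : 0 < sqrtAbsEval g n * Real.exp Δ := mul_pos hspos (Real.exp_pos Δ)
  have hs : sqrtAbsEval g n * Real.exp Δ ≤ e := by
    have h2 : (sqrtAbsEval g n * Real.exp Δ) ^ 2 ≤ (e : ℝ) ^ 2 := by
      rw [mul_pow]
      unfold sqrtAbsEval
      rwa [Real.sq_sqrt (by positivity)]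
    exact (pow_le_pow_iff_left₀ hprod.le (by positivity) two_ne_zero).mp h2
  have hepos : (0 : ℝ) < e := hprod.trans_le hs
  refine hypWeight_eq_zero hΔ ?_
  rw [Real.le_log_iff_exp_le (div_pos hepos hspos), le_div_iff₀ hspos]
  linarith [mul_comm (Real.exp Δ) (sqrtAbsEval g n)]

/-- The smooth small storey `∑_{n≤x} ∑_{e ∣ g(n), e ≤ x} a_e(n)`. [this work] -/
noncomputable def polySmoothSmall (g : ℤ[X]) (Δ : ℝ) (x : ℕ) : ℝ :=
  ∑ n ∈ Icc 1 x, ∑ e ∈ ((g.eval (n : ℤ)).natAbs.divisors).filter (fun e => e ≤ x), locWeight g Δ e n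

/-- The SMOOTH LOCATED COUNT `Mid^w_g(x) = ∑_{n≤x} ∑_{e ∣ g(n), e > x} w_Δ(e/√|g(n)|)`. [this work] -/
noncomputable def polySmoothMid (g : ℤ[X]) (Δ : ℝ) (x : ℕ) : ℝ :=
  ∑ n ∈ Icc 1 x, ∑ e ∈ ((g.eval (n : ℤ)).natAbs.divisors).filter (fun e => x < e), locWeight g Δ e n

/-- **The exact smooth split** `S_g(x) = 2·Small^w_g(x) + 2·Mid^w_g(x)` (`g ≠ 0` on `[1, x]`, `Δ ≠ 0`). [this work] -/
theorem polyDivisorSum_eq_two_mul_smooth (g : ℤ[X]) {Δ : ℝ} (hΔ : Δ ≠ 0) {x : ℕ}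
    (hg0 : ∀ n ∈ Icc 1 x, g.eval (n : ℤ) ≠ 0) :
    (polyDivisorSum g x : ℝ) = 2 * polySmoothSmall g Δ x + 2 * polySmoothMid g Δ x := by
  unfold polyDivisorSum polySmoothSmall polySmoothMid
  rw [Nat.cast_sum, mul_sum, mul_sum, ← sum_add_distrib]
  refine sum_congr rfl fun n hn => ?_
  have hN : (g.eval (n : ℤ)).natAbs ≠ 0 := Int.natAbs_ne_zero.mpr (hg0 n hn)
  have key : (#(g.eval (n : ℤ)).natAbs.divisors : ℝ)
      = 2 * ∑ d ∈ (g.eval (n : ℤ)).natAbs.divisors, locWeight g Δ d n := by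
    have := card_divisors_eq_two_mul_sum_weight (hypWeight Δ) (fun t _ => hypWeight_add_inv hΔ t) hN
    simpa only [locWeight, sqrtAbsEval] using this
  have hf : ((g.eval (n : ℤ)).natAbs.divisors).filter (fun e => x < e)
      = ((g.eval (n : ℤ)).natAbs.divisors).filter (fun e => ¬ e ≤ x) := by
    ext e
    simp only [mem_filter, not_le]
  rw [hf, key, ← mul_add, sum_filter_add_sum_filter_not]

/-- `Small^w_g(x) ≤ Small_g(x)` (the weight is `≤ 1`). [this work] -/
theorem polySmoothSmall_le (g : ℤ[X]) (Δ : ℝ) (x : ℕ) : polySmoothSmall g Δ x ≤ polySmallStorey g x := by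
  unfold polySmoothSmall polySmallStorey
  push_cast
  refine sum_le_sum fun n _ => ?_
  calc ∑ e ∈ ((g.eval (n : ℤ)).natAbs.divisors).filter (fun e => e ≤ x), locWeight g Δ e n
      ≤ ∑ _e ∈ ((g.eval (n : ℤ)).natAbs.divisors).filter (fun e => e ≤ x), (1 : ℝ) :=
        sum_le_sum fun e _ => locWeight_le_one g Δ e n
    _ = #(((g.eval (n : ℤ)).natAbs.divisors).filter (fun e => e ≤ x)) := by
        rw [sum_const, nsmul_eq_mul, mul_one]
    _ ≤ _ := le_rfl

/-- **Only small values of `|g(n)|` see the weight below `x`**: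
`Small_g(x) − Small^w_g(x) ≤ ∑_{n ≤ x, |g(n)| < e^{2Δ}x²} τ(|g(n)|)` (`Δ > 0`). [this work] -/
theorem polySmallStorey_sub_smooth_le (g : ℤ[X]) {Δ : ℝ} (hΔ : 0 < Δ) (x : ℕ) :
    (polySmallStorey g x : ℝ) - polySmoothSmall g Δ x
      ≤ ∑ n ∈ (Icc 1 x).filter (fun n : ℕ => ((g.eval (n : ℤ)).natAbs : ℝ) < ((x : ℝ) * Real.exp Δ) ^ 2),
          (#(g.eval (n : ℤ)).natAbs.divisors : ℝ) := by
  unfold polySmallStorey polySmoothSmall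
  rw [Nat.cast_sum, ← sum_sub_distrib, sum_filter]
  refine sum_le_sum fun n _ => ?_
  set D := ((g.eval (n : ℤ)).natAbs.divisors).filter (fun e => e ≤ x) with hD
  split_ifs with hsmall
  · have h0 : 0 ≤ ∑ e ∈ D, locWeight g Δ e n := sum_nonneg fun e _ => locWeight_nonneg g Δ e n
    have h1 : (#D : ℝ) ≤ #(g.eval (n : ℤ)).natAbs.divisors := by
      exact_mod_cast card_le_card (filter_subset _ _)
    linarith
  · rw [not_lt] at hsmall
    have h1 : ∑ e ∈ D, locWeight g Δ e n = ∑ _e ∈ D, (1 : ℝ) := by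
      refine sum_congr rfl fun e he => ?_
      rw [hD, mem_filter] at he
      have he1 : 1 ≤ e := Nat.pos_of_mem_divisors he.1
      refine locWeight_eq_one g hΔ he1 (le_trans ?_ hsmall)
      have : (e : ℝ) ≤ x := by exact_mod_cast he.2
      exact pow_le_pow_left₀ (by positivity) (mul_le_mul_of_nonneg_right this (Real.exp_pos Δ).le) 2
    rw [h1, sum_const, nsmul_eq_mul, mul_one, sub_self]

/-! ### Fubini past `x` and the smooth heuristic -/

/-- **Fubini**: `Mid^w_g(x) = ∑_{x<e≤E} ∑_{ν root of g mod e, 1 ≤ ν ≤ x} a_e(ν)` for every `E` with `|g(n)| ≤ E`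
on `[1, x]` (`g ≠ 0` there). [this work] -/
theorem polySmoothMid_eq_sum (g : ℤ[X]) (Δ : ℝ) {x E : ℕ} (hg0 : ∀ n ∈ Icc 1 x, g.eval (n : ℤ) ≠ 0)
    (hE : ∀ n ∈ Icc 1 x, (g.eval (n : ℤ)).natAbs ≤ E) :
    polySmoothMid g Δ x = ∑ e ∈ Ioc x E, ∑ ν ∈ rootResidues g e ∩ Icc 1 x, locWeight g Δ e ν := by
  unfold polySmoothMid
  have h1 : ∀ n ∈ Icc 1 x,
      ∑ e ∈ ((g.eval (n : ℤ)).natAbs.divisors).filter (fun e => x < e), locWeight g Δ e n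
        = ∑ e ∈ Ioc x E, if (e : ℤ) ∣ g.eval (n : ℤ) then locWeight g Δ e n else 0 := by
    intro n hn
    have hN := Int.natAbs_ne_zero.mpr (hg0 n hn)
    rw [← sum_filter]
    congr 1
    ext e
    simp only [mem_filter, Nat.mem_divisors, mem_Ioc, Int.natCast_dvd]
    constructor
    · rintro ⟨⟨hd, -⟩, h1⟩
      exact ⟨⟨h1, (Nat.le_of_dvd (Nat.pos_of_ne_zero hN) hd).trans (hE n hn)⟩, hd⟩
    · rintro ⟨⟨h1, -⟩, hd⟩
      exact ⟨⟨hd, hN⟩, h1⟩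
  rw [sum_congr rfl h1, sum_comm]
  refine sum_congr rfl fun e he => ?_
  rw [← sum_filter, Icc_filter_dvd_eq_rootResidues_inter g (mem_Ioc.mp he).1]

/-- The SMOOTH CRT HEURISTIC `H^w_g(x; E) = ∑_{x<e≤E} (ρ_g(e)/e)·∑_{n≤x} a_e(n)`. [this work] -/
noncomputable def polySmoothHeur (g : ℤ[X]) (Δ : ℝ) (x E : ℕ) : ℝ :=
  ∑ e ∈ Ioc x E, (polyRootCountMod ![g] e : ℝ) / e * ∑ n ∈ Icc 1 x, locWeight g Δ e n

/-- `0 ≤ H^w_g(x; E)`. [folklore] -/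
theorem polySmoothHeur_nonneg (g : ℤ[X]) (Δ : ℝ) (x E : ℕ) : 0 ≤ polySmoothHeur g Δ x E :=
  sum_nonneg fun _ _ => mul_nonneg (by positivity) (sum_nonneg fun _ _ => locWeight_nonneg _ _ _ _)

/-- `0 ≤ Mid^w_g(x)`. [folklore] -/
theorem polySmoothMid_nonneg (g : ℤ[X]) (Δ : ℝ) (x : ℕ) : 0 ≤ polySmoothMid g Δ x :=
  sum_nonneg fun _ _ => sum_nonneg fun _ _ => locWeight_nonneg _ _ _ _

end Summit.Parity.BatemanHorn.Theorems
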